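import Mathlib
import Summits.QuantumFields.YangMills.Theorems.LangevinControlUVOSLegsAtWeakCouplingCStubRopeAnchor
import Summits.QuantumFields.YangMills.Theorems.ConvexGribovBodyContinuumLegGivenGapStubObsGeometry
import HarnessLib

/-!
# `ContinuumFromLatticeGap` (stmt-QuantumFields-15915), line `registered` (reshape 6): `stub_monomialConstants`

Support file for the crux item stmt-QuantumFields-15915
(`Summit.QuantumFields.YangMills.Theses.GronwallGap.ContinuumFromLatticeGap`), registered stub
`stub_monomialConstants` of the line `registered` (reshape 6): **UNIFORM monomial constants**.

**Statement.** UNIFORM is volume-uniform exponential clustering with ONE constant per PAIR of local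
gauge-invariant species (`YMSpecies G`): for all `A B` there is `C` with
`|corr(A, B; n)| ≤ C e^{-mh_k n}` for all `k`, all tori `2S+1` with `S₁ k ≤ S` and all `n ≤ S`
(`corr = latticeConnectedCorr r.ρ (β k) (2S+1)`).  Then there is ONE constant `Cmono n d ≥ 1` per arity `n`
and box size `d` such that for every plaquette MONOMIAL `M := ∏_{l ∈ s} plane (q l) (y l)` (`s ⊆ Fin n`,
orientations `q l`, sites `y l` with `0 ≤ y_l⁰ ≤ d`, `|y_lⁱ| ≤ d`) the reflected diagonal pair obeys
`|corr(M ∘ Θ, M; j)| ≤ Cmono n d · e^{-mh_k j}` (`Θ = gaugeTimeReflect`), same range of `k, S, j`.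

**Proof.** (1) Every monomial is a species (`exists_species_prod_plane`: products of translated plaquette
fields are bounded measurable gauge-invariant cylinder observables) and so is its bond reflection
(`obsGeometry_species_reflect`; `MeasurableInv G` from the topological group structure and `BorelSpace G`).
(2) UNIFORM at the pair (reflected monomial, monomial) gives one constant per geometry `(n, s, q, y)`
(classical choice).  (3) The geometries of arity `n` with sites in the box `[-d, d]⁴ ⊇ {0 ≤ y⁰ ≤ d, |yⁱ| ≤ d}`
are finitely many: `Cmono n d := 1 + Σ_q Σ_{y ∈ ([-d,d]⁴)ⁿ} Σ_s |C(n, s, q, y)|` dominates each of them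
(`Finset.single_le_sum`, all terms non-negative) and is `≥ 1`.

No definitions, no facts; Mathlib + the landed species bookkeeping only. References: K. Osterwalder,
E. Seiler, Ann. Phys. 110 (1978) 440, §2; J. Glimm, A. Jaffe, *Quantum Physics* (1987), §19.3
(folklore manipulations). [folklore]
-/

noncomputable section

namespace Summit.QuantumFields.YangMills.Theorems.ContinuumFromLatticeGap

open Filter Topology MeasureTheory
open Literature.MathematicalPhysics.QuantumFieldTheory Literature.MathematicalPhysics.QuantumLattice
  Literature.MathematicalPhysics.AQFT Literature.Probability.LatticeModels
open Summit.QuantumFields.YangMills.Cruxes.OSLegsFromFemtoAndGap.DlrCollarTransfer (plane)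
open Summit.QuantumFields.YangMills.Theorems.OSLegsAtWeakCouplingC.Anchor (exists_species_prod_plane)
open Summit.QuantumFields.YangMills.Theorems.ContinuumLegGivenGap (obsGeometry_species_reflect)

/-- **UNIFORM monomial constants** (stub `stub_monomialConstants` of the line `registered`, reshape 6, of
stmt-QuantumFields-15915).  From UNIFORM (one clustering constant per PAIR of local gauge-invariant species, for
all `k`, tori `S ≥ S₁ k`, separations `n ≤ S`) there is ONE constant `Cmono n d ≥ 1` per arity `n` and box size `d`
bounding the reflected diagonal clustering of every plaquette monomial `∏_{l∈s} plane (q l) (y l)` (`s ⊆ Fin n`,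
sites with `0 ≤ y_l⁰ ≤ d`, `|y_lⁱ| ≤ d`): each monomial (`exists_species_prod_plane`) and its reflection
(`obsGeometry_species_reflect`) are species, UNIFORM gives a constant per geometry, and the sum of their absolute
values over the finitely many geometries of arity `n` in the box `[-d, d]⁴` (plus one) dominates each. [folklore] -/
theorem stub_monomialConstants :
    ∀ (G : Type) [Group G] [TopologicalSpace G] [IsTopologicalGroup G] [CompactSpace G]
      [MeasurableSpace G] [BorelSpace G] (r : LatticeRep G) (β mh : ℕ → ℝ) (S₁ : ℕ → ℕ),
      (∀ A B : YMSpecies G, ∃ C : ℝ, ∀ k S n : ℕ, S₁ k ≤ S → n ≤ S →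
        |latticeConnectedCorr r.ρ (β k) (2 * S + 1) A.F B.F n| ≤ C * Real.exp (-(mh k * n))) →
      ∃ Cmono : ℕ → ℕ → ℝ, (∀ n d, 1 ≤ Cmono n d) ∧
        ∀ (n d : ℕ) (q : Fin n → Fin 4 × Fin 4) (y : Fin n → Site 4),
          (∀ l, (0 ≤ y l 0 ∧ y l 0 ≤ (d : ℤ)) ∧ ∀ i : Fin 4, i ≠ 0 → |y l i| ≤ (d : ℤ)) →
          ∀ (s : Finset (Fin n)) (k S j : ℕ), S₁ k ≤ S → j ≤ S →
            |latticeConnectedCorr r.ρ (β k) (2 * S + 1)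
                ((fun V => ∏ l ∈ s, plane G r (q l) (y l) V) ∘ gaugeTimeReflect)
                (fun V => ∏ l ∈ s, plane G r (q l) (y l) V) j| ≤ Cmono n d * Real.exp (-(mh k * j)) := by
  intro G _ _ _ _ _ _ r β mh S₁ hU
  -- (1) species: the monomials and their bond reflections
  choose spec hspec using fun (n : ℕ) (s : Finset (Fin n)) (q : Fin n → Fin 4 × Fin 4) (z : Fin n → Site 4) =>
    exists_species_prod_plane (G := G) r s q z
  choose refl hrefl using fun A : YMSpecies G => obsGeometry_species_reflect A
  -- (2) one UNIFORM constant per pair of species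
  choose C hC using hU
  -- (3) the constants per geometry, summed over the finite box
  set K : (n : ℕ) → Finset (Fin n) → (Fin n → Fin 4 × Fin 4) → (Fin n → Site 4) → ℝ := fun n s q z =>
    |C (refl (spec n s q z)) (spec n s q z)| with hK
  have hKn : ∀ n s q z, 0 ≤ K n s q z := fun n s q z => abs_nonneg _
  refine ⟨fun n d => 1 + ∑ q : Fin n → Fin 4 × Fin 4, ∑ z ∈ Fintype.piFinset (fun _ : Fin n => box 4 d),
    ∑ s : Finset (Fin n), K n s q z, fun n d => ?_, ?_⟩
  · exact le_add_of_nonneg_right (Finset.sum_nonneg fun q _ => Finset.sum_nonneg fun z _ =>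
      Finset.sum_nonneg fun s _ => hKn n s q z)
  intro n d q y hy s k S j hS hj
  -- the sites lie in the box `[-d, d]⁴`
  have hyb : y ∈ Fintype.piFinset (fun _ : Fin n => box 4 d) := by
    refine Fintype.mem_piFinset.2 fun l => mem_box.2 fun i => ?_
    obtain ⟨⟨h0, h0'⟩, hi⟩ := hy l
    by_cases h : i = 0
    · subst h
      exact ⟨by omega, h0'⟩
    · exact abs_le.1 (hi i h)
  -- UNIFORM at the pair (reflected monomial, monomial)
  have h := hC (refl (spec n s q y)) (spec n s q y) k S j hS hj
  rw [(hrefl _).1, hspec] at h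
  refine h.trans (mul_le_mul_of_nonneg_right ?_ (Real.exp_nonneg _))
  -- the geometry's constant is dominated by the sum
  calc C (refl (spec n s q y)) (spec n s q y) ≤ K n s q y := le_abs_self _
    _ ≤ ∑ s' : Finset (Fin n), K n s' q y :=
        Finset.single_le_sum (f := fun s' => K n s' q y) (fun s' _ => hKn n s' q y) (Finset.mem_univ s)
    _ ≤ ∑ z ∈ Fintype.piFinset (fun _ : Fin n => box 4 d), ∑ s' : Finset (Fin n), K n s' q z :=
        Finset.single_le_sum (f := fun z => ∑ s' : Finset (Fin n), K n s' q z)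
          (fun z _ => Finset.sum_nonneg fun s' _ => hKn n s' q z) hyb
    _ ≤ ∑ q' : Fin n → Fin 4 × Fin 4, ∑ z ∈ Fintype.piFinset (fun _ : Fin n => box 4 d),
          ∑ s' : Finset (Fin n), K n s' q' z :=
        Finset.single_le_sum (f := fun q' => ∑ z ∈ Fintype.piFinset (fun _ : Fin n => box 4 d),
            ∑ s' : Finset (Fin n), K n s' q' z)
          (fun q' _ => Finset.sum_nonneg fun z _ => Finset.sum_nonneg fun s' _ => hKn n s' q' z)
          (Finset.mem_univ q)
    _ ≤ 1 + ∑ q' : Fin n → Fin 4 × Fin 4, ∑ z ∈ Fintype.piFinset (fun _ : Fin n => box 4 d),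
          ∑ s' : Finset (Fin n), K n s' q' z := le_add_of_nonneg_left zero_le_one

end Summit.QuantumFields.YangMills.Theorems.ContinuumFromLatticeGap

end
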